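import Summits.ValiantsHypothesis.ValiantsHypothesis.Theorems.KPlusLogSqLawTridiagonalRealStaticWronskianLinks

/-!
# Route «KPlusLogSqLaw», crux `WeakLifting` (stmt-ValiantsHypothesis-19561) — REAL side of the tridiagonal sector:
# the general-link Christoffel–Darboux identity with a FREE GAUGE CONSTANT — the full gauge cone, and which vertex pays for a root of each type

HONEST FRAMING.  Helper (`--supports stmt-ValiantsHypothesis-19561 --as helper`), seat val-sym-lift-p2 (g15), cell `pub-symmetroid`, 2026-08-28;
α register (static definite symmetric tridiagonal row `B m`), UPPER / structure side; a KERNEL TOOL, no count law.  The companion file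
`…TridiagonalRealStaticWronskianLinks` (same seat, p633021) proved, for the continuants `D_k = pathDet a d b f k`, the identity
`X·Wr(D_{k+1}, D_k) = G_k D_k D_{k+1} + Σ_{j ≤ k} a_j (d_j − G_j) X^{d_j} (∏_{j ≤ i < k}(b_i X^{f_i})²) D_j²` for the alternating antiderivative `G` of the
doubled link exponents NORMALISED BY `G 0 = 0`.  But `G` is determined by the links only up to its initial value: replacing `G 0` by `G 0 + 2δ`
replaces `G_j` by `G_j + 2(−1)^j δ`, and these are exactly the diagonal monomial congruences of the design.  THIS FILE removes the normalisation:

* `X_mul_wronskian_eq_sum_links'` — the identity for EVERY `G : ℕ → ℤ` with `G (j+1) = 2 f_j − G j` (any `G 0`), all designs, all `k`;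
  `x_mul_wronskian_eval_links'`, `x_mul_derivative_mul_eval_of_root'` — the real-point form and the SIGNED SUM OF SQUARES at a root.
* `derivative_mul_prev_pos_of_cone'` / `derivative_mul_prev_neg_of_anticone'` — the one-type laws on the FULL gauge cone
  `{∃ G 0 : G_j ≤ d_j (j ≤ k), G_0 < d_0}` resp. anticone `{d_j ≤ G_j, d_0 < G_0}` (`0 < a_j`, links `≠ 0`): at every positive root of `D_{k+1}`,
  `D_{k+1}′ D_k > 0` resp. `< 0`.  In slope language (`L_t = 2f_t − d_t − d_{t+1}`) the cone is `{−L_t = λ_t + λ_{t+1}, λ ≥ 0, λ_0 > 0}` with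
  `λ_j = d_j − G_j` — the class a diagonal monomial congruence carries to val-sym-lift-p2 g10's Loewner-monotone vertex gauge
  (`…MonotonePencilInertia.card_posRoots_vertexGauge_le_half`); one-signed SLOPES alone are not enough (tree witness
  `exists_static_definite_tridiagonal_four_three`: links `2X, 3X³, 2X`, `L = (2, 6, 2)`, three zeros `> ⌊4/2⌋`, roots of both types).
* `strictMonoOn_gauge_ratio'`, `atMostOne_root_next_of_cone'` — on the full cone the gauged ratio `x^{−G_k} D_{k+1}/D_k` is strictly increasing on every
  window of `(0, ∞)` free of zeros of `D_k`, so `D_{k+1}` has at most one zero per window (g11's `atMostOne_root_next` beyond constant links).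
* `exists_virtual_of_rootType` — WHICH VERTEX PAYS (all designs with `0 < a_j`): at a positive root of `D_{k+1}` with `D_{k+1}′ D_k < 0` some `j ≤ k` has
  `d_j < G_j` and `D_j ≠ 0` there; with `D_{k+1}′ D_k > 0` some `j ≤ k` has `G_j < d_j` and `D_j ≠ 0` — for every choice of the gauge constant.
READING for the cell's particle bookkeeping (located, not claimed here): along `x` the zeros of `D_m` of the register's extremal designs alternate
between the two types with `min(N⁺, N⁻) = m − 2` on the confluent families (`B 5 = 7`, `B 6 ≥ 9`, `B 7 ≥ 11`, `B 8 ≥ 12` designs) and Sturm count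
in `{1, 2}`; the seed-and-switch ladder trades a unit of `min(N⁺, N⁻)` for a unit of `|Δν|`.  Nothing here bears on `WeakLifting` / `TropicalB`
(stmt-19771) in their windows, on Conjecture B, on the Door-A registers, on `MatrixDescartes` (stmt-ValiantsHypothesis-18050) or on VP ≠ VNP.
[folklore: Christoffel–Darboux / Sturm for three-term recurrences; bookkeeping of this seat]
-/

set_option linter.dupNamespace false
set_option autoImplicit false

namespace Summit.ValiantsHypothesis.ValiantsHypothesis.Theorems.KPlusLogSqLaw

namespace StaticTridiagonalRealPotential

open Polynomial Finset

variable (a : ℕ → ℝ) (d : ℕ → ℕ) (b : ℕ → ℝ) (f : ℕ → ℕ)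

/-! ## The free gauge constant: the FULL cone

The alternating antiderivative `G` is determined by the links only up to its initial value `G 0` (changing `G 0` by `2δ` changes `G_j` by
`2(−1)^j δ`): the identity of §1 holds for EVERY initial value, and the diagonal monomial congruences of a design form this one-parameter
family.  The true gauge cone of val-sym-lift-p2 g10's Loewner law is therefore `{∃ G 0 : G_j ≤ d_j ∀ j}` (for the slope vector
`L_t = 2f_t − d_t − d_{t+1}` this reads `−L_t = λ_t + λ_{t+1}` with all `λ_j = d_j − G_j ≥ 0`), not only its slice `G 0 = 0`; the primed theorems
below restate §§1–4 with `G 0` free (strictness at the vertex `0`: `G 0 < d 0`, resp. `d 0 < G 0` on the anticone). -/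

/-- **Christoffel–Darboux for general links, free gauge constant**: for EVERY `G : ℕ → ℤ` with `G (j+1) = 2 f_j − G j` (any `G 0`) and every `k`,
`X·(D_{k+1}′ D_k − D_{k+1} D_k′) = G_k · D_k D_{k+1} + Σ_{j ≤ k} a_j (d_j − G_j) X^{d_j} (∏_{j ≤ i < k} (b_i X^{f_i})²) D_j²`.
[folklore: Christoffel–Darboux; bookkeeping of this seat] -/
theorem X_mul_wronskian_eq_sum_links' (G : ℕ → ℤ) (hG : ∀ j, G (j + 1) = 2 * (f j : ℤ) - G j) (k : ℕ) :
    (X : ℝ[X]) * (derivative (pathDet a d b f (k + 1)) * pathDet a d b f k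
        - pathDet a d b f (k + 1) * derivative (pathDet a d b f k)) =
      C ((G k : ℝ)) * pathDet a d b f k * pathDet a d b f (k + 1) +
      ∑ j ∈ range (k + 1), C (a j * ((d j : ℝ) - (G j : ℝ))) * X ^ d j *
        (∏ i ∈ Ico j k, (C (b i) * X ^ f i) ^ 2) * pathDet a d b f j ^ 2 := by
  induction k with
  | zero =>
    rw [sum_range_one]
    simp only [zero_add, pathDet_one, pathDet_zero, derivative_one, mul_zero, sub_zero, mul_one, Ico_self, prod_empty,
      one_pow]
    have hC : C (a 0 * ((d 0 : ℝ) - ((G 0 : ℤ) : ℝ))) = C (a 0 * (d 0 : ℝ)) - C (((G 0 : ℤ) : ℝ)) * C (a 0) := by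
      rw [← map_mul, ← map_sub]; congr 1; ring
    rw [X_mul_derivative_monomial, hC]
    ring
  | succ n ih =>
    have hstep := X_mul_wronskian_step a d b f n
    have hrec : pathDet a d b f (n + 2) =
        (C (a (n + 1)) * X ^ d (n + 1)) * pathDet a d b f (n + 1) - (C (b n) * X ^ f n) ^ 2 * pathDet a d b f n :=
      pathDet_add_two a d b f n
    have hB2 : (C (b n) * (X : ℝ[X]) ^ f n) ^ 2 = C (b n ^ 2) * X ^ (2 * f n) := by
      rw [mul_pow, ← map_pow, ← pow_mul, mul_comm (f n) 2]
    have hGr : ((G (n + 1) : ℤ) : ℝ) = 2 * (f n : ℝ) - ((G n : ℤ) : ℝ) := by exact_mod_cast hG n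
    have hR : (∑ j ∈ range (n + 1 + 1), C (a j * ((d j : ℝ) - (G j : ℝ))) * X ^ d j *
          (∏ i ∈ Ico j (n + 1), (C (b i) * X ^ f i) ^ 2) * pathDet a d b f j ^ 2) =
        (∑ j ∈ range (n + 1), C (a j * ((d j : ℝ) - (G j : ℝ))) * X ^ d j *
          (∏ i ∈ Ico j (n + 1), (C (b i) * X ^ f i) ^ 2) * pathDet a d b f j ^ 2) +
          C (a (n + 1) * ((d (n + 1) : ℝ) - (G (n + 1) : ℝ))) * X ^ d (n + 1) * pathDet a d b f (n + 1) ^ 2 := by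
      rw [Finset.sum_range_succ, Ico_self, prod_empty, mul_one]
    have hT : ∀ j ∈ range (n + 1), C (a j * ((d j : ℝ) - (G j : ℝ))) * X ^ d j *
          (∏ i ∈ Ico j (n + 1), (C (b i) * X ^ f i) ^ 2) * pathDet a d b f j ^ 2 =
        (C (b n) * X ^ f n) ^ 2 * (C (a j * ((d j : ℝ) - (G j : ℝ))) * X ^ d j *
          (∏ i ∈ Ico j n, (C (b i) * X ^ f i) ^ 2) * pathDet a d b f j ^ 2) := by
      intro j hj
      have hjn : j ≤ n := Nat.lt_succ_iff.mp (mem_range.mp hj)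
      rw [Finset.prod_Ico_succ_top hjn]
      ring
    rw [show n + 1 + 1 = n + 2 from rfl] at hR ⊢
    rw [hR, Finset.sum_congr rfl hT, ← Finset.mul_sum]
    have ih' : (∑ j ∈ range (n + 1), C (a j * ((d j : ℝ) - (G j : ℝ))) * X ^ d j *
          (∏ i ∈ Ico j n, (C (b i) * X ^ f i) ^ 2) * pathDet a d b f j ^ 2) =
        (X : ℝ[X]) * (derivative (pathDet a d b f (n + 1)) * pathDet a d b f n
          - pathDet a d b f (n + 1) * derivative (pathDet a d b f n)) -
          C ((G n : ℝ)) * pathDet a d b f n * pathDet a d b f (n + 1) := by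
      rw [ih]; ring
    rw [ih']
    have hC1 : C (((G (n + 1) : ℤ) : ℝ)) = C (2 * (f n : ℝ)) - C (((G n : ℤ) : ℝ)) := by
      rw [hGr, map_sub]
    have hC2 : C (a (n + 1) * ((d (n + 1) : ℝ) - ((G (n + 1) : ℤ) : ℝ))) =
        C (a (n + 1) * (d (n + 1) : ℝ)) - C (a (n + 1)) * C (((G (n + 1) : ℤ) : ℝ)) := by
      rw [← map_mul, ← map_sub]; congr 1; ring
    have hC3 : C (2 * (f n : ℝ) * b n ^ 2) = C (2 * (f n : ℝ)) * C (b n ^ 2) := by rw [← map_mul]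
    rw [hstep, hC2, hC3, hB2, hrec, hC1]
    simp only [map_pow, map_mul]
    ring

/-- Real-point form of `X_mul_wronskian_eq_sum_links'` (free gauge constant). [bookkeeping] -/
theorem x_mul_wronskian_eval_links' (G : ℕ → ℤ) (hG : ∀ j, G (j + 1) = 2 * (f j : ℤ) - G j) (k : ℕ) (x : ℝ) :
    x * ((derivative (pathDet a d b f (k + 1))).eval x * (pathDet a d b f k).eval x
        - (pathDet a d b f (k + 1)).eval x * (derivative (pathDet a d b f k)).eval x) =
      (G k : ℝ) * (pathDet a d b f k).eval x * (pathDet a d b f (k + 1)).eval x +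
      ∑ j ∈ range (k + 1), (a j * ((d j : ℝ) - (G j : ℝ))) * x ^ d j *
        (∏ i ∈ Ico j k, (b i * x ^ f i) ^ 2) * ((pathDet a d b f j).eval x) ^ 2 := by
  have h := congrArg (fun p : ℝ[X] => p.eval x) (X_mul_wronskian_eq_sum_links' a d b f G hG k)
  simp only [eval_mul, eval_X, eval_sub, eval_add, eval_C, eval_finsetSum, eval_pow, eval_prod] at h
  exact h

/-- **The signed sum of squares at a root, free gauge constant**: if `D_{k+1}(x) = 0` then
`x · D_{k+1}′(x) · D_k(x) = Σ_{j ≤ k} a_j (d_j − G_j) x^{d_j} (∏ (b_i x^{f_i})²) D_j(x)²` for every alternating antiderivative `G` (any `G 0`).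
[bookkeeping of this seat] -/
theorem x_mul_derivative_mul_eval_of_root' (G : ℕ → ℤ) (hG : ∀ j, G (j + 1) = 2 * (f j : ℤ) - G j) (k : ℕ)
    {x : ℝ} (hroot : (pathDet a d b f (k + 1)).eval x = 0) :
    x * ((derivative (pathDet a d b f (k + 1))).eval x * (pathDet a d b f k).eval x) =
      ∑ j ∈ range (k + 1), (a j * ((d j : ℝ) - (G j : ℝ))) * x ^ d j *
        (∏ i ∈ Ico j k, (b i * x ^ f i) ^ 2) * ((pathDet a d b f j).eval x) ^ 2 := by
  have h := x_mul_wronskian_eval_links' a d b f G hG k x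
  rw [hroot] at h
  simpa using h

/-- **Cone law on the FULL gauge cone**: `0 < a_j`, links `≠ 0`, some alternating antiderivative `G` (any `G 0`) with `G_j ≤ d_j` for `j ≤ k` and
`G_0 < d_0` ⇒ `D_{k+1}′(x) · D_k(x) > 0` at every positive root `x` of `D_{k+1}`. [bookkeeping of this seat; folklore: Sturm] -/
theorem derivative_mul_prev_pos_of_cone' (G : ℕ → ℤ) (hG : ∀ j, G (j + 1) = 2 * (f j : ℤ) - G j) (k : ℕ)
    (ha : ∀ t, 0 < a t) (hb : ∀ t, b t ≠ 0) (hcone : ∀ j, j ≤ k → (G j : ℝ) ≤ d j) (hstrict : (G 0 : ℝ) < d 0)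
    {x : ℝ} (hx : 0 < x) (hroot : (pathDet a d b f (k + 1)).eval x = 0) :
    0 < (derivative (pathDet a d b f (k + 1))).eval x * (pathDet a d b f k).eval x := by
  have h := x_mul_derivative_mul_eval_of_root' a d b f G hG k hroot
  have hterm : ∀ j ∈ range (k + 1), 0 ≤ (a j * ((d j : ℝ) - (G j : ℝ))) * x ^ d j *
      (∏ i ∈ Ico j k, (b i * x ^ f i) ^ 2) * ((pathDet a d b f j).eval x) ^ 2 := by
    intro j hj
    have hjk : j ≤ k := Nat.lt_succ_iff.mp (mem_range.mp hj)
    have h1 : 0 ≤ a j * ((d j : ℝ) - (G j : ℝ)) := mul_nonneg (ha j).le (sub_nonneg.mpr (hcone j hjk))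
    exact mul_nonneg (mul_nonneg (mul_nonneg h1 (pow_nonneg hx.le _)) (prod_nonneg fun i _ => sq_nonneg _)) (sq_nonneg _)
  have h0 : 0 < (a 0 * ((d 0 : ℝ) - (G 0 : ℝ))) * x ^ d 0 *
      (∏ i ∈ Ico 0 k, (b i * x ^ f i) ^ 2) * ((pathDet a d b f 0).eval x) ^ 2 := by
    rw [pathDet_zero, eval_one, one_pow, mul_one]
    have h1 : 0 < a 0 * ((d 0 : ℝ) - (G 0 : ℝ)) := mul_pos (ha 0) (sub_pos.mpr hstrict)
    have h2 : 0 < ∏ i ∈ Ico 0 k, (b i * x ^ f i) ^ 2 :=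
      prod_pos fun i _ => pow_pos (abs_pos.mpr (mul_ne_zero (hb i) (pow_ne_zero _ hx.ne'))) 2 |>.trans_eq (sq_abs _)
    exact mul_pos (mul_pos h1 (pow_pos hx _)) h2
  have hsum : 0 < ∑ j ∈ range (k + 1), (a j * ((d j : ℝ) - (G j : ℝ))) * x ^ d j *
      (∏ i ∈ Ico j k, (b i * x ^ f i) ^ 2) * ((pathDet a d b f j).eval x) ^ 2 :=
    lt_of_lt_of_le h0 (single_le_sum (f := fun j => (a j * ((d j : ℝ) - (G j : ℝ))) * x ^ d j *
      (∏ i ∈ Ico j k, (b i * x ^ f i) ^ 2) * ((pathDet a d b f j).eval x) ^ 2) hterm (mem_range.mpr (Nat.succ_pos k)))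
  rw [← h] at hsum
  exact (mul_pos_iff_of_pos_left hx).mp hsum

/-- **Anticone law on the FULL gauge anticone**: `0 < a_j`, links `≠ 0`, some alternating antiderivative `G` with `d_j ≤ G_j` for `j ≤ k` and
`d_0 < G_0` ⇒ `D_{k+1}′(x) · D_k(x) < 0` at every positive root `x` of `D_{k+1}` (the mirror `x ↦ 1/x` of the cone law).
[bookkeeping of this seat; folklore: Sturm] -/
theorem derivative_mul_prev_neg_of_anticone' (G : ℕ → ℤ) (hG : ∀ j, G (j + 1) = 2 * (f j : ℤ) - G j) (k : ℕ)
    (ha : ∀ t, 0 < a t) (hb : ∀ t, b t ≠ 0) (hanti : ∀ j, j ≤ k → (d j : ℝ) ≤ G j) (hstrict : (d 0 : ℝ) < G 0)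
    {x : ℝ} (hx : 0 < x) (hroot : (pathDet a d b f (k + 1)).eval x = 0) :
    (derivative (pathDet a d b f (k + 1))).eval x * (pathDet a d b f k).eval x < 0 := by
  have h := x_mul_derivative_mul_eval_of_root' a d b f G hG k hroot
  have hterm : ∀ j ∈ range (k + 1), (a j * ((d j : ℝ) - (G j : ℝ))) * x ^ d j *
      (∏ i ∈ Ico j k, (b i * x ^ f i) ^ 2) * ((pathDet a d b f j).eval x) ^ 2 ≤ 0 := by
    intro j hj
    have hjk : j ≤ k := Nat.lt_succ_iff.mp (mem_range.mp hj)
    have h1 : a j * ((d j : ℝ) - (G j : ℝ)) ≤ 0 := mul_nonpos_of_nonneg_of_nonpos (ha j).le (sub_nonpos.mpr (hanti j hjk))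
    exact mul_nonpos_of_nonpos_of_nonneg (mul_nonpos_of_nonpos_of_nonneg
      (mul_nonpos_of_nonpos_of_nonneg h1 (pow_nonneg hx.le _)) (prod_nonneg fun i _ => sq_nonneg _)) (sq_nonneg _)
  have h0 : (a 0 * ((d 0 : ℝ) - (G 0 : ℝ))) * x ^ d 0 *
      (∏ i ∈ Ico 0 k, (b i * x ^ f i) ^ 2) * ((pathDet a d b f 0).eval x) ^ 2 < 0 := by
    rw [pathDet_zero, eval_one, one_pow, mul_one]
    have h1 : a 0 * ((d 0 : ℝ) - (G 0 : ℝ)) < 0 := mul_neg_of_pos_of_neg (ha 0) (sub_neg.mpr hstrict)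
    have h2 : 0 < ∏ i ∈ Ico 0 k, (b i * x ^ f i) ^ 2 :=
      prod_pos fun i _ => pow_pos (abs_pos.mpr (mul_ne_zero (hb i) (pow_ne_zero _ hx.ne'))) 2 |>.trans_eq (sq_abs _)
    exact mul_neg_of_neg_of_pos (mul_neg_of_neg_of_pos h1 (pow_pos hx _)) h2
  have hsum : ∑ j ∈ range (k + 1), (a j * ((d j : ℝ) - (G j : ℝ))) * x ^ d j *
      (∏ i ∈ Ico j k, (b i * x ^ f i) ^ 2) * ((pathDet a d b f j).eval x) ^ 2 < 0 := by
    have hmem : (0 : ℕ) ∈ range (k + 1) := mem_range.mpr (Nat.succ_pos k)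
    rw [← Finset.add_sum_erase _ _ hmem]
    have hrest : ∑ j ∈ (range (k + 1)).erase 0, (a j * ((d j : ℝ) - (G j : ℝ))) * x ^ d j *
        (∏ i ∈ Ico j k, (b i * x ^ f i) ^ 2) * ((pathDet a d b f j).eval x) ^ 2 ≤ 0 :=
      sum_nonpos fun j hj => hterm j (mem_of_mem_erase hj)
    linarith
  rw [← h] at hsum
  exact neg_of_mul_neg_right hsum hx.le

/-- **The gauged ratio `x^{−G_k} D_{k+1}/D_k` is strictly increasing on the FULL cone** (free `G 0`; `G_j ≤ d_j` for `j ≤ k`, `G_0 < d_0`,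
`0 < a_j`, nonzero links) on every `[u, v] ⊂ (0, ∞)` free of zeros of `D_k`. [folklore: Sturm; bookkeeping of this seat] -/
theorem strictMonoOn_gauge_ratio' (G : ℕ → ℤ) (hG : ∀ j, G (j + 1) = 2 * (f j : ℤ) - G j) (k : ℕ)
    (ha : ∀ t, 0 < a t) (hb : ∀ t, b t ≠ 0) (hcone : ∀ j, j ≤ k → (G j : ℝ) ≤ d j) (hstrict : (G 0 : ℝ) < d 0)
    {u v : ℝ} (hu : 0 < u) (hk : ∀ x ∈ Set.Icc u v, (pathDet a d b f k).eval x ≠ 0) :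
    StrictMonoOn (fun x => x ^ (-(G k)) * ((pathDet a d b f (k + 1)).eval x / (pathDet a d b f k).eval x)) (Set.Icc u v) := by
  set P := pathDet a d b f (k + 1) with hP
  set Q := pathDet a d b f k with hQ
  have hderiv : ∀ x ∈ Set.Icc u v, HasDerivAt (fun y => y ^ (-(G k)) * (P.eval y / Q.eval y))
      (((-(G k) : ℤ) : ℝ) * x ^ (-(G k) - 1) * (P.eval x / Q.eval x) +
        x ^ (-(G k)) * (((derivative P).eval x * Q.eval x - P.eval x * (derivative Q).eval x) / (Q.eval x) ^ 2)) x := by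
    intro x hx
    have hx0 : x ≠ 0 := (hu.trans_le hx.1).ne'
    exact (hasDerivAt_zpow (-(G k)) x (Or.inl hx0)).mul ((P.hasDerivAt x).div (Q.hasDerivAt x) (hk x hx))
  refine strictMonoOn_of_deriv_pos (convex_Icc u v) ?_ ?_
  · exact fun x hx => (hderiv x hx).continuousAt.continuousWithinAt
  · intro x hx
    rw [interior_Icc] at hx
    have hx' : x ∈ Set.Icc u v := Set.Ioo_subset_Icc_self hx
    rw [(hderiv x hx').deriv]
    have hxpos : 0 < x := hu.trans hx.1
    have hQx : Q.eval x ≠ 0 := hk x hx'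
    have hS := x_mul_wronskian_eval_links' a d b f G hG k x
    have hterm : ∀ j ∈ range (k + 1), 0 ≤ (a j * ((d j : ℝ) - (G j : ℝ))) * x ^ d j *
        (∏ i ∈ Ico j k, (b i * x ^ f i) ^ 2) * ((pathDet a d b f j).eval x) ^ 2 := by
      intro j hj
      have hjk : j ≤ k := Nat.lt_succ_iff.mp (mem_range.mp hj)
      have h1 : 0 ≤ a j * ((d j : ℝ) - (G j : ℝ)) := mul_nonneg (ha j).le (sub_nonneg.mpr (hcone j hjk))
      exact mul_nonneg (mul_nonneg (mul_nonneg h1 (pow_nonneg hxpos.le _)) (prod_nonneg fun i _ => sq_nonneg _)) (sq_nonneg _)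
    have h0 : 0 < (a 0 * ((d 0 : ℝ) - (G 0 : ℝ))) * x ^ d 0 *
        (∏ i ∈ Ico 0 k, (b i * x ^ f i) ^ 2) * ((pathDet a d b f 0).eval x) ^ 2 := by
      rw [pathDet_zero, eval_one, one_pow, mul_one]
      have h1 : 0 < a 0 * ((d 0 : ℝ) - (G 0 : ℝ)) := mul_pos (ha 0) (sub_pos.mpr hstrict)
      have h2 : 0 < ∏ i ∈ Ico 0 k, (b i * x ^ f i) ^ 2 :=
        prod_pos fun i _ => pow_pos (abs_pos.mpr (mul_ne_zero (hb i) (pow_ne_zero _ hxpos.ne'))) 2 |>.trans_eq (sq_abs _)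
      exact mul_pos (mul_pos h1 (pow_pos hxpos _)) h2
    have hsum : 0 < ∑ j ∈ range (k + 1), (a j * ((d j : ℝ) - (G j : ℝ))) * x ^ d j *
        (∏ i ∈ Ico j k, (b i * x ^ f i) ^ 2) * ((pathDet a d b f j).eval x) ^ 2 :=
      lt_of_lt_of_le h0 (single_le_sum (f := fun j => (a j * ((d j : ℝ) - (G j : ℝ))) * x ^ d j *
        (∏ i ∈ Ico j k, (b i * x ^ f i) ^ 2) * ((pathDet a d b f j).eval x) ^ 2) hterm (mem_range.mpr (Nat.succ_pos k)))
    have hSpos : 0 < x * ((derivative P).eval x * Q.eval x - P.eval x * (derivative Q).eval x) -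
        (G k : ℝ) * Q.eval x * P.eval x := by
      rw [hP, hQ, hS]; linarith
    have hx1 : x ^ (-(G k)) = x ^ (-(G k) - 1) * x := by
      rw [← zpow_add_one₀ hxpos.ne', sub_add_cancel]
    have key : ((-(G k) : ℤ) : ℝ) * x ^ (-(G k) - 1) * (P.eval x / Q.eval x) +
        x ^ (-(G k)) * (((derivative P).eval x * Q.eval x - P.eval x * (derivative Q).eval x) / (Q.eval x) ^ 2) =
        x ^ (-(G k) - 1) * ((x * ((derivative P).eval x * Q.eval x - P.eval x * (derivative Q).eval x) -
          (G k : ℝ) * Q.eval x * P.eval x) / (Q.eval x) ^ 2) := by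
      rw [hx1]
      field_simp
      push_cast
      ring
    rw [key]
    exact mul_pos (zpow_pos hxpos _) (div_pos hSpos (pow_pos (abs_pos.mpr hQx) 2 |>.trans_eq (sq_abs _)))

/-- **At most one root per window on the FULL cone** (free `G 0`): on any `[u, v] ⊂ (0, ∞)` free of zeros of `D_k`, `D_{k+1}` has at most one zero.
[folklore: Sturm] -/
theorem atMostOne_root_next_of_cone' (G : ℕ → ℤ) (hG : ∀ j, G (j + 1) = 2 * (f j : ℤ) - G j) (k : ℕ)
    (ha : ∀ t, 0 < a t) (hb : ∀ t, b t ≠ 0) (hcone : ∀ j, j ≤ k → (G j : ℝ) ≤ d j) (hstrict : (G 0 : ℝ) < d 0)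
    {u v : ℝ} (hu : 0 < u) (hk : ∀ x ∈ Set.Icc u v, (pathDet a d b f k).eval x ≠ 0)
    {x₁ x₂ : ℝ} (h₁ : x₁ ∈ Set.Icc u v) (h₂ : x₂ ∈ Set.Icc u v)
    (r₁ : (pathDet a d b f (k + 1)).eval x₁ = 0) (r₂ : (pathDet a d b f (k + 1)).eval x₂ = 0) : x₁ = x₂ := by
  have hmono := strictMonoOn_gauge_ratio' a d b f G hG k ha hb hcone hstrict hu hk
  have e : (fun x => x ^ (-(G k)) * ((pathDet a d b f (k + 1)).eval x / (pathDet a d b f k).eval x)) x₁ =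
      (fun x => x ^ (-(G k)) * ((pathDet a d b f (k + 1)).eval x / (pathDet a d b f k).eval x)) x₂ := by
    simp only [r₁, r₂, zero_div, mul_zero]
  exact hmono.injOn h₁ h₂ e

/-- **Every annihilation needs a negative virtual vertex, every creation a positive one** (free gauge constant; `0 < a_j`, `x > 0`): at a
positive root `x` of `D_{k+1}` with `D_{k+1}′(x) D_k(x) < 0` there is `j ≤ k` with `d_j < G_j` and `D_j(x) ≠ 0`; with `> 0` there is `j ≤ k` with
`G_j < d_j` and `D_j(x) ≠ 0`.  (Which vertex pays for a root of each type.) [bookkeeping of this seat] -/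
theorem exists_virtual_of_rootType (G : ℕ → ℤ) (hG : ∀ j, G (j + 1) = 2 * (f j : ℤ) - G j) (k : ℕ)
    (ha : ∀ t, 0 < a t) {x : ℝ} (hx : 0 < x) (hroot : (pathDet a d b f (k + 1)).eval x = 0) :
    ((derivative (pathDet a d b f (k + 1))).eval x * (pathDet a d b f k).eval x < 0 →
        ∃ j, j ≤ k ∧ (d j : ℝ) < G j ∧ (pathDet a d b f j).eval x ≠ 0) ∧
    (0 < (derivative (pathDet a d b f (k + 1))).eval x * (pathDet a d b f k).eval x →
        ∃ j, j ≤ k ∧ (G j : ℝ) < d j ∧ (pathDet a d b f j).eval x ≠ 0) := by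
  have h := x_mul_derivative_mul_eval_of_root' a d b f G hG k hroot
  constructor
  · intro hneg
    by_contra hcon
    have hcon' : ∀ j, j ≤ k → (d j : ℝ) < G j → (pathDet a d b f j).eval x = 0 :=
      fun j hj hlt => by by_contra hD; exact hcon ⟨j, hj, hlt, hD⟩
    -- every term is then ≥ 0: either `G_j ≤ d_j` or `D_j(x) = 0`
    have hterm : ∀ j ∈ range (k + 1), 0 ≤ (a j * ((d j : ℝ) - (G j : ℝ))) * x ^ d j *
        (∏ i ∈ Ico j k, (b i * x ^ f i) ^ 2) * ((pathDet a d b f j).eval x) ^ 2 := by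
      intro j hj
      have hjk : j ≤ k := Nat.lt_succ_iff.mp (mem_range.mp hj)
      by_cases hD : (pathDet a d b f j).eval x = 0
      · rw [hD]; simp
      · have h1 : 0 ≤ a j * ((d j : ℝ) - (G j : ℝ)) :=
          mul_nonneg (ha j).le (sub_nonneg.mpr (not_lt.mp fun hlt => hD (hcon' j hjk hlt)))
        exact mul_nonneg (mul_nonneg (mul_nonneg h1 (pow_nonneg hx.le _)) (prod_nonneg fun i _ => sq_nonneg _)) (sq_nonneg _)
    have hsum := sum_nonneg hterm
    rw [← h] at hsum
    have := mul_neg_of_pos_of_neg hx hneg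
    linarith
  · intro hpos
    by_contra hcon
    have hcon' : ∀ j, j ≤ k → (G j : ℝ) < d j → (pathDet a d b f j).eval x = 0 :=
      fun j hj hlt => by by_contra hD; exact hcon ⟨j, hj, hlt, hD⟩
    have hterm : ∀ j ∈ range (k + 1), (a j * ((d j : ℝ) - (G j : ℝ))) * x ^ d j *
        (∏ i ∈ Ico j k, (b i * x ^ f i) ^ 2) * ((pathDet a d b f j).eval x) ^ 2 ≤ 0 := by
      intro j hj
      have hjk : j ≤ k := Nat.lt_succ_iff.mp (mem_range.mp hj)
      by_cases hD : (pathDet a d b f j).eval x = 0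
      · rw [hD]; simp
      · have h1 : a j * ((d j : ℝ) - (G j : ℝ)) ≤ 0 :=
          mul_nonpos_of_nonneg_of_nonpos (ha j).le (sub_nonpos.mpr (not_lt.mp fun hlt => hD (hcon' j hjk hlt)))
        exact mul_nonpos_of_nonpos_of_nonneg (mul_nonpos_of_nonpos_of_nonneg
          (mul_nonpos_of_nonpos_of_nonneg h1 (pow_nonneg hx.le _)) (prod_nonneg fun i _ => sq_nonneg _)) (sq_nonneg _)
    have hsum := sum_nonpos hterm
    rw [← h] at hsum
    have := mul_pos hx hpos
    linarith

end StaticTridiagonalRealPotential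

end Summit.ValiantsHypothesis.ValiantsHypothesis.Theorems.KPlusLogSqLaw
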